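import Literature.Analysis.FluidPDE.SolenoidalTruncationDecay
import Literature.Analysis.FluidPDE.MildL3Restart
import Literature.Analysis.FluidPDE.MildSolutionProofs
import Literature.Analysis.FluidPDE.MildSolutionHeatFlowProofs
import Literature.Analysis.UnboundedOperators.HeatKernelBoundedData
import Literature.Analysis.UnboundedOperators.HeatExtensionDecay
import HarnessLib

/-!
# Tools for the duality identity with caloric test fields: pairings, decay, the gradient of the
# truncation error

Analysis/FluidPDE support file (serves the discharge of the named fact
`Literature.Analysis.FluidPDE.IsKatoSolutionOn.duality_heatTest`, `KatoRestart.lean`: the duality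
identity of a Kato solution extends to the caloric test fields `e^{νσΔ}φ`). The extension tests
with the solenoidal truncations `Ψ_R` of `ψ = e^{aΔ}φ` (`SolenoidalTruncation.lean`) and lets
`R → ∞`; the linear terms are handled by `MildL3Restart.lean`
(`tendsto_integral_inner_solenoidalTruncation`, symmetry of the heat semigroup), the nonlinear
term needs the gradient of the truncation error to vanish in `L³`, which is what this file
supplies, from the pointwise bounds of `SolenoidalTruncationDecay.lean` and the decay of
`e^{aΔ}φ` (`HeatExtensionDecay.lean`). Contents (all proved):

* `abs_integral_inner_le_eLpNorm_mul` — Hölder bound `|∫⟪a, b⟫| ≤ ‖a‖_p ‖b‖_q` of the pairing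
  of two vector fields (`1/p + 1/q = 1` as `ENNReal.HolderTriple p q 1`);
* `volume_closedBall_two_mul_rpow` — `vol(B̄(0,2R))^q = R^{3q} vol(B̄(0,2))^q` in dimension 3;
* `exists_decay_heatFlow` — sup and weighted bounds `‖y‖³‖ψ‖ ≤ C₃`, `‖y‖⁴‖Dψ‖ ≤ C₄` of
  `ψ = e^{aΔ}φ`, `φ ∈ C¹_c`, `a > 0`;
* `tendsto_eLpNorm_fderiv_caloricTruncation_sub` — **`‖D(Ψ_R − ψ)‖_{L³} → 0`** in dimension
  three (`eLpNorm_fderiv_solenoidalTruncation_sub_le`: `L³` tail of `Dψ`, `(C₁/R)‖ψ‖₃`, and the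
  annulus term `(K/R³)(R³ vol B̄(0,2))^{1/3} = O(R⁻²)`);
* `memLp_fderiv_caloricTruncation_sub`, `memLp_caloricTruncation_sub` — the truncation error and
  its gradient lie in `L³` (all `L^p`).

## Mathlib / tree search

Tree: `tendsto_eLpNorm_indicator_norm_ge`, `integrable_inner_of_memLp_conj`
(`MildL3Restart.lean`), `eLpNorm_fderiv_solenoidalTruncation_sub_le`,
`fderiv_solenoidalTruncation_sub` (`SolenoidalTruncationDecay.lean`),
`UnboundedOperators.exists_pow_mul_norm_heatExtension_le` (`HeatExtensionDecay.lean`),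
`fderiv_heatFlow`, `contDiff_heatFlow`, `memLp_heatFlow_holds`. Mathlib:
`MeasureTheory.eLpNorm_le_eLpNorm_mul_eLpNorm'_of_norm` (bilinear Hölder),
`Measure.addHaar_closedBall_mul`, `ENNReal.Tendsto.mul_const`, `Filter.Tendsto.div_atTop`.

## References

* E. B. Fabes, B. F. Jones, N. M. Rivière, Arch. Rational Mech. Anal. 45 (1972), Thm. 2.1.
-/

noncomputable section

open MeasureTheory Set Filter Topology Metric Function
open scoped ENNReal NNReal RealInnerProductSpace

namespace Literature.Analysis.FluidPDE

/-! ### Hölder pairings of vector fields -/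

section Pairing

variable {X : Type*} [MeasurableSpace X] {μ : Measure X}
variable {F' : Type*} [NormedAddCommGroup F'] [InnerProductSpace ℝ F']

/-- `1 ≤ 3/2` in `ℝ≥0∞` (local copy of `FunctionSpaces.ennreal_one_le_three_halves`, to avoid
importing the torus commutator file). [folklore] -/
private theorem one_le_threeHalves : (1 : ℝ≥0∞) ≤ 3 / 2 :=
  (ENNReal.le_div_iff_mul_le (Or.inl two_ne_zero) (Or.inl ENNReal.ofNat_ne_top)).2 (by norm_num)

/-- **Hölder bound of the pairing**: `|∫ ⟪a, b⟫| ≤ ‖a‖_p ‖b‖_q` for `a ∈ L^p`, `b ∈ L^q`,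
`1/p + 1/q = 1`. [folklore] -/
theorem abs_integral_inner_le_eLpNorm_mul {p q : ℝ≥0∞} [hpq : ENNReal.HolderTriple p q 1]
    {a b : X → F'} (ha : MemLp a p μ) (hb : MemLp b q μ) :
    |∫ x, ⟪a x, b x⟫ ∂μ| ≤ (eLpNorm a p μ * eLpNorm b q μ).toReal := by
  have hint := integrable_inner_of_memLp_conj ha hb
  have h1 : |∫ x, ⟪a x, b x⟫ ∂μ| ≤ (eLpNorm (fun x => ⟪a x, b x⟫) 1 μ).toReal := by
    rw [← Real.norm_eq_abs, eLpNorm_one_eq_lintegral_enorm, ← integral_norm_eq_lintegral_enorm hint.1]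
    exact norm_integral_le_integral_norm _
  refine h1.trans (ENNReal.toReal_mono (ENNReal.mul_ne_top ha.2.ne hb.2.ne) ?_)
  have h := eLpNorm_le_eLpNorm_mul_eLpNorm'_of_norm (μ := μ) ha.1 hb.1 (fun v w => ⟪v, w⟫) 1
    (Eventually.of_forall fun x => by
      rw [NNReal.coe_one, one_mul]; exact norm_inner_le_norm (a x) (b x)) (hpqr := hpq)
  simpa using h

/-- Symmetric form of `abs_integral_inner_le_eLpNorm_mul` (`a ∈ L^q`, `b ∈ L^p`). [folklore] -/
theorem abs_integral_inner_le_eLpNorm_mul' {p q : ℝ≥0∞} [hpq : ENNReal.HolderTriple p q 1]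
    {a b : X → F'} (ha : MemLp a q μ) (hb : MemLp b p μ) :
    |∫ x, ⟪a x, b x⟫ ∂μ| ≤ (eLpNorm a q μ * eLpNorm b p μ).toReal := by
  have h := abs_integral_inner_le_eLpNorm_mul (μ := μ) hb ha
  have heq : ∫ x, ⟪b x, a x⟫ ∂μ = ∫ x, ⟪a x, b x⟫ ∂μ :=
    integral_congr_ae (Eventually.of_forall fun x => real_inner_comm _ _)
  rw [heq] at h
  rwa [mul_comm]

end Pairing

/-! ### Volume of balls in dimension three -/

section Volume

variable {E : Type*} [NormedAddCommGroup E] [InnerProductSpace ℝ E] [FiniteDimensional ℝ E]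
  [MeasurableSpace E] [BorelSpace E]

/-- `vol(B̄(0, 2R))^q = R^{3q} vol(B̄(0,2))^q` in dimension three (`R, q ≥ 0`). [folklore] -/
theorem volume_closedBall_two_mul_rpow (hE : Module.finrank ℝ E = 3) {R : ℝ} (hR : 0 ≤ R)
    {q : ℝ} (hq : 0 ≤ q) :
    volume (closedBall (0 : E) (2 * R)) ^ q =
      ENNReal.ofReal (R ^ (3 * q)) * volume (closedBall (0 : E) 2) ^ q := by
  rw [mul_comm (2 : ℝ) R, Measure.addHaar_closedBall_mul volume (0 : E) hR zero_le_two, hE,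
    ENNReal.mul_rpow_of_nonneg _ _ hq, ENNReal.ofReal_rpow_of_nonneg (pow_nonneg hR 3) hq,
    ← Real.rpow_natCast R 3, ← Real.rpow_mul hR]
  norm_num

/-- The closed ball of radius `2` has finite volume. [folklore] -/
theorem volume_closedBall_two_rpow_ne_top {q : ℝ} (hq : 0 ≤ q) :
    volume (closedBall (0 : E) 2) ^ q ≠ ⊤ :=
  ENNReal.rpow_ne_top_of_nonneg hq measure_closedBall_lt_top.ne

end Volume

/-! ### The caloric test field and its solenoidal truncation -/

section Caloric

variable {E : Type*} [NormedAddCommGroup E] [InnerProductSpace ℝ E] [FiniteDimensional ℝ E]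
  [MeasurableSpace E] [BorelSpace E]
variable {φ : E → E} {a : ℝ}

/-- The derivative of the caloric field falls on the data (function form of the tree's
`fderiv_heatFlow`). [folklore] -/
theorem fderiv_heatFlow_eq (hφ : ContDiff ℝ 1 φ) (hc : HasCompactSupport φ) (a : ℝ) :
    fderiv ℝ (heatFlow φ a) = heatFlow (fderiv ℝ φ) a :=
  funext (fderiv_heatFlow hφ hc a)

/-- The caloric field of a test field lies in every `L^p`, `1 ≤ p` (`0 ≤ a`). [folklore] -/
theorem memLp_heatFlow_of_hasCompactSupport (hφ : Continuous φ) (hc : HasCompactSupport φ)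
    {p : ℝ≥0∞} (hp : 1 ≤ p) (ha : 0 ≤ a) : MemLp (heatFlow φ a) p volume :=
  memLp_heatFlow_holds (hφ.memLp_of_hasCompactSupport hc) hp ha

/-- The derivative of the caloric field of a test field lies in every `L^p`, `1 ≤ p`. [folklore] -/
theorem memLp_fderiv_heatFlow_of_hasCompactSupport (hφ : ContDiff ℝ 1 φ) (hc : HasCompactSupport φ)
    {p : ℝ≥0∞} (hp : 1 ≤ p) (ha : 0 ≤ a) : MemLp (fderiv ℝ (heatFlow φ a)) p volume := by
  rw [fderiv_heatFlow_eq hφ hc]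
  exact memLp_heatFlow_holds
    ((hφ.continuous_fderiv one_ne_zero).memLp_of_hasCompactSupport (hc.fderiv ℝ)) hp ha

/-- **Decay constants of the caloric field of a test field** (`0 < a`): sup bounds and the
weighted bounds `‖y‖³‖ψ(y)‖ ≤ C₃`, `‖y‖⁴‖Dψ(y)‖ ≤ C₄` for `ψ = e^{aΔ}φ`
(`exists_pow_mul_norm_heatExtension_le` for `φ` and `Dφ`). [folklore] -/
theorem exists_decay_heatFlow (hφ : ContDiff ℝ 1 φ) (hc : HasCompactSupport φ) (ha : 0 < a) :
    ∃ B₀ C₃ B₁ C₄ : ℝ, (∀ y, ‖heatFlow φ a y‖ ≤ B₀) ∧ (∀ y, ‖y‖ ^ 3 * ‖heatFlow φ a y‖ ≤ C₃) ∧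
      (∀ y, ‖fderiv ℝ (heatFlow φ a) y‖ ≤ B₁) ∧
      (∀ y, ‖y‖ ^ 4 * ‖fderiv ℝ (heatFlow φ a) y‖ ≤ C₄) := by
  have hφc : Continuous φ := hφ.continuous
  have hDφc : Continuous (fderiv ℝ φ) := hφ.continuous_fderiv one_ne_zero
  have hDc : HasCompactSupport (fderiv ℝ φ) := hc.fderiv ℝ
  obtain ⟨B₀, -, h0⟩ := UnboundedOperators.exists_pow_mul_norm_heatExtension_le hφc hc ha 0
  obtain ⟨C₃, -, h3⟩ := UnboundedOperators.exists_pow_mul_norm_heatExtension_le hφc hc ha 3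
  obtain ⟨B₁, -, h1⟩ := UnboundedOperators.exists_pow_mul_norm_heatExtension_le hDφc hDc ha 0
  obtain ⟨C₄, -, h4⟩ := UnboundedOperators.exists_pow_mul_norm_heatExtension_le hDφc hDc ha 4
  refine ⟨B₀, C₃, B₁, C₄, fun y => ?_, fun y => ?_, fun y => ?_, fun y => ?_⟩
  · rw [heatFlow_of_pos φ ha]; simpa using h0 y
  · rw [heatFlow_of_pos φ ha]; simpa using h3 y
  · rw [fderiv_heatFlow_eq hφ hc, heatFlow_of_pos _ ha]; simpa using h1 y
  · rw [fderiv_heatFlow_eq hφ hc, heatFlow_of_pos _ ha]; simpa using h4 y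

/-- **The gradient of the truncation error of a caloric test field tends to zero in `L³`**
(dimension three): `‖D(Ψ_R - ψ)‖₃ ≤ ‖1_{≥R}Dψ‖₃ + (C₁/R)‖ψ‖₃ + (K'/R³)(R³ vol B̄(0,2))^{1/3} → 0`.
[folklore] -/
theorem tendsto_eLpNorm_fderiv_caloricTruncation_sub (hE : Module.finrank ℝ E = 3)
    (hφ : ContDiff ℝ 1 φ) (hc : HasCompactSupport φ) (ha : 0 < a) :
    Tendsto (fun R : ℝ => eLpNorm
      (fderiv ℝ fun x => solenoidalTruncation (heatFlow φ a) R x - heatFlow φ a x) 3 volume)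
      atTop (𝓝 0) := by
  obtain ⟨C₁, hC₁, hC⟩ := exists_norm_fderiv_cutoff_le (E := E)
  obtain ⟨C₂, hC₂, hC'⟩ := exists_norm_fderiv_fderiv_cutoff_le (E := E)
  obtain ⟨B₀, C₃, B₁, C₄, h0, h3, h1, h4⟩ := exists_decay_heatFlow hφ hc ha
  have hψ1 : ContDiff ℝ 1 (heatFlow φ a) := contDiff_heatFlow hφ hc a
  have hψ3 : MemLp (heatFlow φ a) 3 volume :=
    memLp_heatFlow_of_hasCompactSupport hφ.continuous hc (by norm_num) ha.le
  have hDψ3 : MemLp (fderiv ℝ (heatFlow φ a)) 3 volume :=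
    memLp_fderiv_heatFlow_of_hasCompactSupport hφ hc (by norm_num) ha.le
  have hDψc : Continuous (fderiv ℝ (heatFlow φ a)) := hψ1.continuous_fderiv one_ne_zero
  have hB₀ : 0 ≤ B₀ := (norm_nonneg _).trans (h0 0)
  have hC₃ : 0 ≤ C₃ := by simpa using h3 0
  have hB₁ : 0 ≤ B₁ := (norm_nonneg _).trans (h1 0)
  have hC₄ : 0 ≤ C₄ := by simpa using h4 0
  set K' : ℝ := 4 * C₁ * (B₁ + C₄) + (2 * C₁ + 4 * C₂) * (B₀ + C₃) with hK'
  have hK'0 : 0 ≤ K' := by positivity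
  set V : ℝ≥0∞ := volume (closedBall (0 : E) 2) ^ (1 / 3 : ℝ) with hV
  have hVtop : V ≠ ⊤ := volume_closedBall_two_rpow_ne_top (by norm_num)
  set bound : ℝ → ℝ≥0∞ := fun R =>
    eLpNorm ({y : E | R ≤ ‖y‖}.indicator (fderiv ℝ (heatFlow φ a))) 3 volume +
      ENNReal.ofReal (C₁ / R) * eLpNorm (heatFlow φ a) 3 volume + ENNReal.ofReal (K' / R ^ 2) * V
    with hbound
  have htail := tendsto_eLpNorm_indicator_norm_ge (p := 3) (by norm_num) (by norm_num) hDψ3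
  have hmid : Tendsto (fun R : ℝ => ENNReal.ofReal (C₁ / R) * eLpNorm (heatFlow φ a) 3 volume)
      atTop (𝓝 0) := by
    have h1 : Tendsto (fun R : ℝ => C₁ / R) atTop (𝓝 0) := tendsto_const_nhds.div_atTop tendsto_id
    have h2 := ENNReal.tendsto_ofReal h1
    rw [ENNReal.ofReal_zero] at h2
    have h3 := ENNReal.Tendsto.mul_const h2 (Or.inr hψ3.2.ne)
    rwa [zero_mul] at h3
  have hlast : Tendsto (fun R : ℝ => ENNReal.ofReal (K' / R ^ 2) * V) atTop (𝓝 0) := by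
    have h1 : Tendsto (fun R : ℝ => K' / R ^ 2) atTop (𝓝 0) :=
      tendsto_const_nhds.div_atTop (tendsto_pow_atTop two_ne_zero)
    have h2 := ENNReal.tendsto_ofReal h1
    rw [ENNReal.ofReal_zero] at h2
    have h3 := ENNReal.Tendsto.mul_const h2 (Or.inr hVtop)
    rwa [zero_mul] at h3
  have hb : Tendsto bound atTop (𝓝 0) := by
    simpa using (htail.add hmid).add hlast
  refine tendsto_of_tendsto_of_tendsto_of_le_of_le' tendsto_const_nhds hb
    (Eventually.of_forall fun R => bot_le) ?_
  filter_upwards [eventually_ge_atTop (1 : ℝ)] with R hR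
  have hR0 : 0 < R := one_pos.trans_le hR
  have h := eLpNorm_fderiv_solenoidalTruncation_sub_le (V := heatFlow φ a) hC₁ hC₂ hC hC' hψ1
    h0 h3 h1 h4 (p := 3) (by norm_num) hR
  have hexp : (1 / (3 : ℝ≥0∞).toReal : ℝ) = 1 / 3 := by norm_num
  rw [hexp, volume_closedBall_two_mul_rpow hE hR0.le (by norm_num : (0 : ℝ) ≤ 1 / 3)] at h
  refine h.trans (le_of_eq ?_)
  simp only [hbound]
  congr 1
  rw [← mul_assoc, ← ENNReal.ofReal_mul (by positivity)]
  congr 2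
  have : (3 : ℝ) * (1 / 3) = 1 := by norm_num
  rw [this, Real.rpow_one, hK']
  field_simp

/-- The gradient of the truncation error of a caloric test field lies in `L³`. [folklore] -/
theorem memLp_fderiv_caloricTruncation_sub (hφ : ContDiff ℝ (⊤ : ℕ∞) φ) (hc : HasCompactSupport φ)
    (ha : 0 < a) {R : ℝ} (hR : 0 < R) :
    MemLp (fderiv ℝ fun x => solenoidalTruncation (heatFlow φ a) R x - heatFlow φ a x) 3 volume := by
  have hψ : ContDiff ℝ (⊤ : ℕ∞) (heatFlow φ a) := contDiff_heatFlow hφ hc a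
  have hψ1 : ContDiff ℝ 1 (heatFlow φ a) := hψ.of_le (by norm_cast)
  have hθ := isTestFunctionOn_solenoidalTruncation (V := heatFlow φ a) hψ hR
  have heq : (fderiv ℝ fun x => solenoidalTruncation (heatFlow φ a) R x - heatFlow φ a x) =
      fun x => fderiv ℝ (solenoidalTruncation (heatFlow φ a) R) x - fderiv ℝ (heatFlow φ a) x :=
    funext fun x => fderiv_solenoidalTruncation_sub hψ1 R x
  rw [heq]
  refine MemLp.sub ?_ (memLp_fderiv_heatFlow_of_hasCompactSupport
    (hφ.of_le (by norm_cast)) hc (by norm_num) ha.le)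
  exact ((hθ.contDiff.continuous_fderiv (by simp)).memLp_of_hasCompactSupport
    (hθ.hasCompactSupport.fderiv ℝ))

/-- The truncation error of a caloric test field lies in every `L^p`, `1 ≤ p`. [folklore] -/
theorem memLp_caloricTruncation_sub (hφ : ContDiff ℝ (⊤ : ℕ∞) φ) (hc : HasCompactSupport φ)
    (ha : 0 < a) {R : ℝ} (hR : 0 < R) {p : ℝ≥0∞} (hp : 1 ≤ p) :
    MemLp (fun x => solenoidalTruncation (heatFlow φ a) R x - heatFlow φ a x) p volume := by
  have hψ : ContDiff ℝ (⊤ : ℕ∞) (heatFlow φ a) := contDiff_heatFlow hφ hc a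
  have hθ := isTestFunctionOn_solenoidalTruncation (V := heatFlow φ a) hψ hR
  exact (hθ.contDiff.continuous.memLp_of_hasCompactSupport hθ.hasCompactSupport).sub
    (memLp_heatFlow_of_hasCompactSupport hφ.continuous hc hp ha.le)

end Caloric

end Literature.Analysis.FluidPDE
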